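/-
Copyright (c) 2026 the pub-hodgecm-mathlib formalisation cell (harness21).  Prover seat hodgecm-mathlib-K2E3-p14 (g7), Track B «K2-LIT» ∕ h413
(`stmt-HodgeConjecture-24833`), line `K2_E3_EllipticInputs`, leaf (nsc-S-A′) «principal-block standard span», brick E2-J twin (P₁₂ side), part 1:
BLOCK BOOKKEEPING FOR `B ≤ P₁₂ ≤ GL₃(F)` AND `δ_B^{1∕2} = δ_{P₁₂}^{1∕2} · δ_{B₂}^{1∕2}`.  2026-09-04.
-/
import Summits.HodgeConjecture.HodgeConjecture.Theorems.K2E3GL3InductionInStagesEmbedding   -- ★ E2-I∕E2-δ (P₂₁ side): patterns, `rootDeltaChar_borel_three`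
import HarnessLib

/-!
# K2_E3 road (h413), leaf (nsc-S-A′), brick E2-J twin for `Q′ = P₁₂` — block bookkeeping and `δ_B^{1∕2} = δ_{P₁₂}^{1∕2} · δ_{B₂}^{1∕2}`

Cell `pub/hodgecm-mathlib` (D-0151), Track B, seat K2E3-p14 (g7); architect K2E3-p25 (g2) H0 HEADS FREEZE 2026-09-04 11:28:14Z (the (1,2)-family of the exponent rules needs
the `![false,true,true]` twin of the BRIDGE; token «twin=yes» 11:29Z).  `--supports stmt-HodgeConjecture-24833 --as helper`; THEOREMS ONLY; never imports `Cruxes/…/Lines`.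
COUNT-NEUTRAL.  The P₂₁ originals are ★ `K2E3GL3InductionInStagesEmbedding` (K2E3-p14 (g6)); here `Q′ = P₁₂ = standardParabolicGL F ![false,true,true]` (block `false = {0}` =
`GL₁`, block `true = {1,2}` = `GL₂`), `ι′(g₂) = diag(1, g₂)` along `e : Fin 2 ≃ {1,2}` with `(e j).val = j.succ`, `d′(t) = diag(t,1,1)`.
* §1 the labelling; §2 entries of `diag(1, g₂)`; §3 blocks of `q ∈ Q′` and of `b ∈ B` (`e⁻¹(b|_{GL₂})` is in the Borel of `GL₂`, `det b|_{GL₂} = b₁₁ b₂₂`, `det b|_{GL₁} = b₀₀`);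
* §4 **`rootDeltaChar_borel_three_eq_mul'`**: `δ_B^{1∕2}(b) = δ_{P₁₂}^{1∕2}(b) · δ_{B₂}^{1∕2}(e⁻¹(b|_{GL₂}))` (`‖a‖‖c‖⁻¹ = (‖a‖²‖bc‖⁻¹)^{1∕2} (‖b‖‖c‖⁻¹)^{1∕2}`;
  ★ `rootDeltaChar_borel_three`, ★ `rootDeltaChar_standardParabolicGL_bool`, ★ `coe_rootDeltaChar_standardParabolicGL_fin_two`).
[cite: BernsteinZelevinsky1977, §2.1, 1.7, §2.3]

HONEST LABEL: HC_CM is proved only modulo the 7 printed citations (2 remaining named inputs: hLiu418 = stmt-HodgeConjecture-24832, h413 =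
stmt-HodgeConjecture-24833) until rung 0 closes; count-neutral helper.

## References
* [BernsteinZelevinsky1977] I. N. Bernstein, A. V. Zelevinsky, Ann. Sci. ÉNS 10 (1977): §2.1, 1.7, Prop. 1.9, §2.3.
* [Bump1997] D. Bump, *Automorphic Forms and Representations* (1997): §4.5.
-/

set_option autoImplicit false
set_option linter.dupNamespace false

noncomputable section
open scoped MatrixGroups NNReal
namespace Summit.HodgeConjecture.HodgeConjecture.Cruxes.H413.K2E3GL3OneTwoLeviBookkeeping

open Literature.NumberTheory.Automorphic
open Literature.NumberTheory.GaloisRepresentations Literature.NumberTheory.GaloisRepresentations.IsNonarchimedeanLocalField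

/-! ## §1 The labelling `![false,true,true]` -/

/-- The labelling `![false,true,true]` of `Fin 3` is monotone (so `B ≤ P₁₂`). [folklore] -/
theorem monotone_oneTwo : Monotone (![false, true, true] : Fin 3 → Bool) := by decide

/-- The `false`-block of `![false,true,true]` is the single index `0`. [folklore] -/
theorem subsingleton_block_false : Subsingleton {i : Fin 3 // (![false, true, true] : Fin 3 → Bool) i = false} := by
  refine ⟨fun i j => Subtype.ext ?_⟩
  have hi := i.2
  have hj := j.2
  revert hi hj
  rcases i with ⟨i, _⟩
  rcases j with ⟨j, _⟩
  fin_cases i <;> fin_cases j <;> simp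

/-- The labelling sends `succ i` (`i < 2`) to `true`. [folklore] -/
theorem oneTwo_succ (i : Fin 2) : (![false, true, true] : Fin 3 → Bool) (Fin.succ i) = true := by
  fin_cases i <;> rfl

/-! ## §2 Entries of `ι′(g₂) = diag(1, g₂)` -/

section Blocks

variable {F : Type*} [Field F]
  (e : Fin 2 ≃ {i : Fin 3 // (![false, true, true] : Fin 3 → Bool) i = true}) (he : ∀ j : Fin 2, ((e j : {i : Fin 3 // (![false, true, true] : Fin 3 → Bool) i = true}) : Fin 3) = Fin.succ j)

include he in
/-- Entries of `ι′(g₂) = diag(1, g₂)` in the `GL₂`-block: `ι′(g₂)_{i+1,j+1} = (g₂)_{ij}`. [folklore] -/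
theorem blockEmbedding_apply_succ (g₂ : GL (Fin 2) F) (i j : Fin 2) :
    (((((leviEmbeddingP F (![false, true, true] : Fin 3 → Bool) (Pi.mulSingle (M := (fun a : Bool => GL {i : Fin 3 // (![false, true, true] : Fin 3 → Bool) i = a} F)) true (reindexGL e g₂))) : ↥(standardParabolicGL F (![false, true, true] : Fin 3 → Bool))) : GL (Fin 3) F)) :
        Matrix (Fin 3) (Fin 3) F) (Fin.succ i) (Fin.succ j) = ((g₂ : GL (Fin 2) F) : Matrix (Fin 2) (Fin 2) F) i j := by
  have h := leviProjection_apply_coe (R := F) (c := (![false, true, true] : Fin 3 → Bool)) (leviEmbeddingP F (![false, true, true] : Fin 3 → Bool) (Pi.mulSingle (M := (fun a : Bool => GL {i : Fin 3 // (![false, true, true] : Fin 3 → Bool) i = a} F)) true (reindexGL e g₂))) true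
    ⟨Fin.succ i, oneTwo_succ i⟩ ⟨Fin.succ j, oneTwo_succ j⟩
  dsimp only at h
  rw [← h, leviProjection_leviEmbeddingP_apply, Pi.mulSingle_eq_same, coe_reindexGL, Matrix.reindex_apply, Matrix.submatrix_apply]
  have hi : e.symm ⟨Fin.succ i, oneTwo_succ i⟩ = i := by rw [Equiv.symm_apply_eq]; exact Subtype.ext (he i).symm
  have hj : e.symm ⟨Fin.succ j, oneTwo_succ j⟩ = j := by rw [Equiv.symm_apply_eq]; exact Subtype.ext (he j).symm
  rw [hi, hj]

/-- The corner entry of `ι′(g₂) = diag(1, g₂)`: `ι′(g₂)₀₀ = 1`. [folklore] -/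
theorem blockEmbedding_apply_zero_zero (g₂ : GL (Fin 2) F) :
    (((((leviEmbeddingP F (![false, true, true] : Fin 3 → Bool) (Pi.mulSingle (M := (fun a : Bool => GL {i : Fin 3 // (![false, true, true] : Fin 3 → Bool) i = a} F)) true (reindexGL e g₂))) : ↥(standardParabolicGL F (![false, true, true] : Fin 3 → Bool))) : GL (Fin 3) F)) :
        Matrix (Fin 3) (Fin 3) F) 0 0 = 1 := by
  have h := leviProjection_apply_coe (R := F) (c := (![false, true, true] : Fin 3 → Bool)) (leviEmbeddingP F (![false, true, true] : Fin 3 → Bool) (Pi.mulSingle (M := (fun a : Bool => GL {i : Fin 3 // (![false, true, true] : Fin 3 → Bool) i = a} F)) true (reindexGL e g₂))) false ⟨0, rfl⟩ ⟨0, rfl⟩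
  dsimp only at h
  rw [← h, leviProjection_leviEmbeddingP_apply, Pi.mulSingle_eq_of_ne (show false ≠ true by decide), Units.val_one, Matrix.one_apply_eq]

/-- `ι′(g₂)_{0,j+1} = 0`. [folklore] -/
theorem blockEmbedding_apply_zero_succ (g₂ : GL (Fin 2) F) (j : Fin 2) :
    (((((leviEmbeddingP F (![false, true, true] : Fin 3 → Bool) (Pi.mulSingle (M := (fun a : Bool => GL {i : Fin 3 // (![false, true, true] : Fin 3 → Bool) i = a} F)) true (reindexGL e g₂))) : ↥(standardParabolicGL F (![false, true, true] : Fin 3 → Bool))) : GL (Fin 3) F)) :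
        Matrix (Fin 3) (Fin 3) F) 0 (Fin.succ j) = 0 := by
  rw [coe_leviEmbeddingP, blockDiagonalGL_apply_coe_dite, dif_neg (by rw [oneTwo_succ]; decide)]

/-- `ι′(g₂)_{i+1,0} = 0`. [folklore] -/
theorem blockEmbedding_apply_succ_zero (g₂ : GL (Fin 2) F) (i : Fin 2) :
    (((((leviEmbeddingP F (![false, true, true] : Fin 3 → Bool) (Pi.mulSingle (M := (fun a : Bool => GL {i : Fin 3 // (![false, true, true] : Fin 3 → Bool) i = a} F)) true (reindexGL e g₂))) : ↥(standardParabolicGL F (![false, true, true] : Fin 3 → Bool))) : GL (Fin 3) F)) :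
        Matrix (Fin 3) (Fin 3) F) (Fin.succ i) 0 = 0 := by
  rw [coe_leviEmbeddingP, blockDiagonalGL_apply_coe_dite, dif_neg (by rw [oneTwo_succ]; decide)]

end Blocks

/-! ## §3 Blocks of `q ∈ P₁₂` and of `b ∈ B` -/

section Reindex

variable {F : Type*} [Field F]
  (e : Fin 2 ≃ {i : Fin 3 // (![false, true, true] : Fin 3 → Bool) i = true}) (he : ∀ j : Fin 2, ((e j : {i : Fin 3 // (![false, true, true] : Fin 3 → Bool) i = true}) : Fin 3) = Fin.succ j)

include he in
/-- Entries of the `GL₂`-block of `q ∈ P₁₂`, reindexed to `Fin 2`: `(block q)_{ij} = q_{i+1,j+1}`. [folklore] -/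
theorem reindex_block_apply' (q : ↥(standardParabolicGL F (![false, true, true] : Fin 3 → Bool))) (i j : Fin 2) :
    (((reindexGL e).symm (leviProjection F (![false, true, true] : Fin 3 → Bool) q true) : GL (Fin 2) F) : Matrix (Fin 2) (Fin 2) F) i j =
      ((q : GL (Fin 3) F) : Matrix (Fin 3) (Fin 3) F) (Fin.succ i) (Fin.succ j) := by
  rw [reindexGL_symm, coe_reindexGL, Matrix.reindex_apply, Matrix.submatrix_apply, Equiv.symm_symm, leviProjection_apply_coe, he, he]

/-- The `GL₁`-block of `q ∈ P₁₂` has determinant `q₀₀`. [cite: BernsteinZelevinsky1977, §2.1] -/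
theorem det_leviProjection_oneTwo_false (q : ↥(standardParabolicGL F (![false, true, true] : Fin 3 → Bool))) :
    ((Matrix.GeneralLinearGroup.det (leviProjection F (![false, true, true] : Fin 3 → Bool) q false) : Fˣ) : F) = ((q : GL (Fin 3) F) : Matrix (Fin 3) (Fin 3) F) 0 0 := by
  haveI := subsingleton_block_false
  rw [Matrix.GeneralLinearGroup.val_det_apply, Matrix.det_eq_elem_of_subsingleton _ (⟨0, rfl⟩ : {i : Fin 3 // (![false, true, true] : Fin 3 → Bool) i = false}), leviProjection_apply_coe]

include he in
/-- For `b` in the Borel of `GL₃`, its `GL₂`-block `e⁻¹(b|_{\{1,2\}})` lies in the Borel of `GL₂`. [cite: BernsteinZelevinsky1977, §2.1] -/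
theorem reindex_block_mem_borel_two' (b : ↥(standardParabolicGL F (id : Fin 3 → Fin 3))) :
    (reindexGL e).symm (leviProjection F (![false, true, true] : Fin 3 → Bool) ⟨(b : GL (Fin 3) F), borel_le_standardParabolicGL monotone_oneTwo b.2⟩ true) ∈
      standardParabolicGL F (id : Fin 2 → Fin 2) := by
  rw [mem_standardParabolicGL_iff]
  intro i j hij
  rw [reindex_block_apply' e he]
  exact blockTriangular_of_mem b (show (id (Fin.succ j) : Fin 3) < id (Fin.succ i) from Fin.succ_lt_succ_iff.2 hij)

include he in
/-- The `GL₂`-block of `b ∈ B ≤ GL₃` has determinant `b₁₁ b₂₂`. [cite: BernsteinZelevinsky1977, §2.1] -/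
theorem det_block_true_eq (b : ↥(standardParabolicGL F (id : Fin 3 → Fin 3))) :
    ((Matrix.GeneralLinearGroup.det (leviProjection F (![false, true, true] : Fin 3 → Bool) ⟨(b : GL (Fin 3) F), borel_le_standardParabolicGL monotone_oneTwo b.2⟩ true) : Fˣ) : F) =
      ((b : GL (Fin 3) F) : Matrix (Fin 3) (Fin 3) F) 1 1 * ((b : GL (Fin 3) F) : Matrix (Fin 3) (Fin 3) F) 2 2 := by
  have h21 : ((b : GL (Fin 3) F) : Matrix (Fin 3) (Fin 3) F) 2 1 = 0 :=
    blockTriangular_of_mem b (show (id (1 : Fin 3)) < id (2 : Fin 3) by decide)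
  have hdet : (((reindexGL e).symm (leviProjection F (![false, true, true] : Fin 3 → Bool) ⟨(b : GL (Fin 3) F), borel_le_standardParabolicGL monotone_oneTwo b.2⟩ true) : GL (Fin 2) F) :
        Matrix (Fin 2) (Fin 2) F).det =
      ((leviProjection F (![false, true, true] : Fin 3 → Bool) ⟨(b : GL (Fin 3) F), borel_le_standardParabolicGL monotone_oneTwo b.2⟩ true : GL {i : Fin 3 // (![false, true, true] : Fin 3 → Bool) i = true} F) : Matrix {i : Fin 3 // (![false, true, true] : Fin 3 → Bool) i = true} {i : Fin 3 // (![false, true, true] : Fin 3 → Bool) i = true} F).det := by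
    rw [reindexGL_symm, coe_reindexGL, Matrix.det_reindex_self]
  rw [Matrix.GeneralLinearGroup.val_det_apply, ← hdet, Matrix.det_fin_two, reindex_block_apply' e he, reindex_block_apply' e he,
    reindex_block_apply' e he, reindex_block_apply' e he]
  simp [h21]

end Reindex

/-! ## §4 `δ_B^{1∕2} = δ_{P₁₂}^{1∕2} · δ_{B₂}^{1∕2}` on the Borel of `GL₃(F)` -/

section Delta

variable {F : Type*} [Field F] [ValuativeRel F] [TopologicalSpace F] [IsNonarchimedeanLocalField F]
  (e : Fin 2 ≃ {i : Fin 3 // (![false, true, true] : Fin 3 → Bool) i = true}) (he : ∀ j : Fin 2, ((e j : {i : Fin 3 // (![false, true, true] : Fin 3 → Bool) i = true}) : Fin 3) = Fin.succ j)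

include he in
/-- **`δ_B^{1∕2}(b) = δ_{P₁₂}^{1∕2}(b) · δ_{B₂}^{1∕2}(b|_{\{1,2\}})` on the Borel of `GL₃(F)`**: `‖a‖‖c‖⁻¹ = (‖a‖²‖bc‖⁻¹)^{1∕2} · (‖b‖‖c‖⁻¹)^{1∕2}`
(★ `rootDeltaChar_borel_three`, ★ `rootDeltaChar_standardParabolicGL_bool`, ★ `coe_rootDeltaChar_standardParabolicGL_fin_two`). [cite: BernsteinZelevinsky1977, 1.7 and §2.3]
[cite: Bump1997, §4.5] -/
theorem rootDeltaChar_borel_three_eq_mul' (b : ↥(standardParabolicGL F (id : Fin 3 → Fin 3))) :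
    ((rootDeltaChar (standardParabolicGL F (id : Fin 3 → Fin 3)) b : ℂˣ) : ℂ) =
      ((rootDeltaChar (standardParabolicGL F (![false, true, true] : Fin 3 → Bool)) ⟨(b : GL (Fin 3) F), borel_le_standardParabolicGL monotone_oneTwo b.2⟩ : ℂˣ) : ℂ) *
        ((rootDeltaChar (standardParabolicGL F (id : Fin 2 → Fin 2))
          ⟨(reindexGL e).symm (leviProjection F (![false, true, true] : Fin 3 → Bool) ⟨(b : GL (Fin 3) F), borel_le_standardParabolicGL monotone_oneTwo b.2⟩ true),
            reindex_block_mem_borel_two' e he b⟩ : ℂˣ) : ℂ) := by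
  have h0 := K2E3GL3BorelModulus.diag_ne_zero_of_mem_borel b 0
  have h1 := K2E3GL3BorelModulus.diag_ne_zero_of_mem_borel b 1
  have h2 := K2E3GL3BorelModulus.diag_ne_zero_of_mem_borel b 2
  have hcard2 : Fintype.card {i : Fin 3 // (![false, true, true] : Fin 3 → Bool) i = true} = 2 := by decide
  have hcard1 : Fintype.card {i : Fin 3 // (![false, true, true] : Fin 3 → Bool) i = false} = 1 := by decide
  rw [K2E3GL3BorelModulus.rootDeltaChar_borel_three, rootDeltaChar_standardParabolicGL_bool, coe_rootDeltaChar_standardParabolicGL_fin_two,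
    hcard1, hcard2, det_block_true_eq e he, det_leviProjection_oneTwo_false]
  dsimp only
  rw [reindex_block_apply' e he, reindex_block_apply' e he]
  simp only [Fin.succ_zero_eq_one, Fin.succ_one_eq_two, pow_one]
  rw [← Complex.ofReal_mul, ← NNReal.coe_mul, ← NNReal.sqrt_mul]
  congr 2
  symm
  rw [NNReal.sqrt_eq_iff_eq_sq, map_mul, map_div₀]
  have ha : normAbs F (((b : GL (Fin 3) F) : Matrix (Fin 3) (Fin 3) F) 0 0) ≠ 0 := fun h => h0 ((map_eq_zero (normAbs F)).1 h)
  have hb : normAbs F (((b : GL (Fin 3) F) : Matrix (Fin 3) (Fin 3) F) 1 1) ≠ 0 := fun h => h1 ((map_eq_zero (normAbs F)).1 h)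
  have hc : normAbs F (((b : GL (Fin 3) F) : Matrix (Fin 3) (Fin 3) F) 2 2) ≠ 0 := fun h => h2 ((map_eq_zero (normAbs F)).1 h)
  field_simp

end Delta

end Summit.HodgeConjecture.HodgeConjecture.Cruxes.H413.K2E3GL3OneTwoLeviBookkeeping

end
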